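import Summits.CriticalPhenomena.PercolationContinuityZ3.Theorems.Transplant.FKConnectivityAllQApexHubRestAlg
import Summits.CriticalPhenomena.PercolationContinuityZ3.Theorems.Transplant.FKConnectivityAllQApexHubThree
import Summits.CriticalPhenomena.PercolationContinuityZ3.Theorems.Transplant.FKConnectivityAllQApexHubTwoAlg
import Summits.CriticalPhenomena.PercolationContinuityZ3.Theorems.Transplant.FKConnectivityAllQApexDiamond
import HarnessLib

/-!
# Connectivity correlation inequalities for `φ_{w,q}` — the HUB INEQUALITY WITH AN APEX TERMINAL AND A TERMINAL IN THE REST OF THE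
# GRAPH, file 2: three REDUCTION THEOREMS ("an apex terminal may be traded for the opposite hub"), EVERY `q > 0`

Support file (`--supports stmt-CriticalPhenomena-4575`), census seat `prim-bschramm-census` (gen 23) of the post-continuity programme;
builds on p205010 (kernel theorem, internal audit signed; external expert review pending).  No definitions, no named facts, no sorries;
standard axioms.  Continues `…ApexHubRestAlg.lean` (cells, certificates) and the census seat gen 22's apex files (table lemma).
SETTING: `x` an APEX over `(u, v)` (every live pair at `x` is `ux` or `xv`), `t ≠ x` ANY further vertex, the rest of the weighted graph
arbitrary; `w° = w[ux, xv ↦ 0]`.  For ALR's hub inequality `HubUnder μ o a b` (`μ(o ↔ a)·μ(b ↔ a) ≤ μ(o ↔ a ↔ b)`), every `q > 0`: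
**`hubUnder_apex_rest_o`** `HubUnder φ_{w°,q} v u t → HubUnder φ_{w,q} x u t`; **`hubUnder_apex_rest_a`** `HubUnder φ_{w°,q} u v t →
HubUnder φ_{w,q} u x t` (hub at the apex); **`hubUnder_apex_rest_b`** `HubUnder φ_{w°,q} u t v → HubUnder φ_{w,q} x t u` (hub in the rest):
in each hub placement on the triple `{x, u, t}` the apex may be replaced by the opposite hub `v` and its pairs deleted.  The two-rest-terminal
placements `(x; t; z)`, `(t; x; z)` do NOT reduce to hub inequalities of the rest by a certificate of this kind (exact LP, census gen 23 memo).
[cite: AyyerLinussonRavichandran2025, §7 eq. (13)–(15), Conj. 7.1 (p. 22)] [cite: Grimmett2006, Thm. (3.1)(a) (p. 37); §1.4 eq. (1.20) (p. 15); §3.9 (p. 63)]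
-/

noncomputable section

namespace Summit.CriticalPhenomena.PercolationContinuityZ3.Theorems

namespace FK

open MeasureTheory Set Literature.Probability.LatticeModels Literature.Probability.Percolation
open Literature.Probability.Percolation.DecisionTree (ind ind_of_mem ind_of_not_mem ind_nonneg)
open Literature.Probability.Percolation.TwoAvoidanceSets (ind_mul_ind)
open scoped Classical symmDiff

variable {V : Type*} [Fintype V]

/-- **Reduction `(x; u; t) ← (v; u; t)`**: for an apex `x` over `(u, v)` and any `t ≠ x`, the hub inequality
`φ_{w,q}(x ↔ u)·φ_{w,q}(t ↔ u) ≤ φ_{w,q}(x ↔ u ↔ t)` follows from the hub inequality `φ°(v ↔ u)·φ°(t ↔ u) ≤ φ°(v ↔ u ↔ t)` of the rest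
(`φ° = φ_{w[ux,xv↦0],q}`), for EVERY `q > 0`. [cite: AyyerLinussonRavichandran2025, §7 eq. (13)–(14) (p. 22)] [cite: Grimmett2006, §3.9 (p. 63); Thm. (3.8)] -/
theorem hubUnder_apex_rest_o (w : Sym2 V → unitInterval) {q : ℝ} (hq : 0 < q) {u v x t : V} (hxu : x ≠ u) (hxv : x ≠ v)
    (huv : u ≠ v) (htx : t ≠ x) (hw : ∀ e : Sym2 V, x ∈ e → ((w e : unitInterval) : ℝ) ≠ 0 → u ∈ e ∨ v ∈ e)
    (hrest : HubUnder (rcMeasureW (Function.update (Function.update w s(u, x) 0) s(x, v) 0) q ∅) v u t) :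
    HubUnder (rcMeasureW w q ∅) x u t := by
  have hq0 : q ≠ 0 := hq.ne'
  set K : Set (BondConfig V) := {ω : BondConfig V | ω \ {s(u, x), s(x, v)} ∈ (openConn u v : Set (BondConfig V))} with hK
  set Tu : Set (BondConfig V) := {ω : BondConfig V | ω \ {s(u, x), s(x, v)} ∈ (openConn u t : Set (BondConfig V))} with hTu
  set Tv : Set (BondConfig V) := {ω : BondConfig V | ω \ {s(u, x), s(x, v)} ∈ (openConn v t : Set (BondConfig V))} with hTv
  have hKb : ∀ ω : BondConfig V, ω ∆ {s(x, v)} ∈ K ↔ ω ∈ K := apexAvoid_insens u v x (Or.inr rfl)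
  have hTua : ∀ ω : BondConfig V, ω ∆ {s(u, x)} ∈ Tu ↔ ω ∈ Tu := diffApex_insens u v x _ (Or.inl rfl)
  have hTub : ∀ ω : BondConfig V, ω ∆ {s(x, v)} ∈ Tu ↔ ω ∈ Tu := diffApex_insens u v x _ (Or.inr rfl)
  have hTva : ∀ ω : BondConfig V, ω ∆ {s(u, x)} ∈ Tv ↔ ω ∈ Tv := diffApex_insens u v x _ (Or.inl rfl)
  have hTvb : ∀ ω : BondConfig V, ω ∆ {s(x, v)} ∈ Tv ↔ ω ∈ Tv := diffApex_insens u v x _ (Or.inr rfl)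
  have hapex := fun ω (hω : rcWeightW w q ∅ ω ≠ 0) => apex_of_rcWeightW_ne_zero w q hxu hxv hw hω
  have hKiff : ∀ ω : BondConfig V, ω ∈ K ↔ (openGraph (ω \ {s(u, x), s(x, v)})).Reachable u v := fun ω => by
    rw [hK, Set.mem_setOf_eq, mem_openConn_iff']
  have hTuiff : ∀ ω : BondConfig V, ω ∈ Tu ↔ (openGraph (ω \ {s(u, x), s(x, v)})).Reachable u t := fun ω => by
    rw [hTu, Set.mem_setOf_eq, mem_openConn_iff']
  have hTviff : ∀ ω : BondConfig V, ω ∈ Tv ↔ (openGraph (ω \ {s(u, x), s(x, v)})).Reachable v t := fun ω => by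
    rw [hTv, Set.mem_setOf_eq, mem_openConn_iff']
  have hAiff : ∀ ω, rcWeightW w q ∅ ω ≠ 0 →
      (ω ∈ (openConn x u : Set (BondConfig V)) ↔ s(u, x) ∈ ω ∨ (s(x, v) ∈ ω ∧ ω ∈ K)) := fun ω hω => by
    rw [openConn_comm, mem_openConn_iff', reachable_ux_apex_iff hxu hxv (hapex ω hω), hKiff]
  have hBiff : ∀ ω, rcWeightW w q ∅ ω ≠ 0 →
      (ω ∈ (openConn t u : Set (BondConfig V)) ↔ ω ∈ Tu ∨ (s(u, x) ∈ ω ∧ s(x, v) ∈ ω ∧ ω ∈ Tv)) := fun ω hω => by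
    rw [openConn_comm, mem_openConn_iff', reachable_uy_apex_iff hxu hxv htx (hapex ω hω), hTuiff, hTviff]
  have hA := apex_mass_table w hq0 hxu hxv huv hw (openConn x u) Set.univ Set.univ K ∅
    (fun ω hω ha _ => iff_of_true ((hAiff ω hω).2 (Or.inl ha)) (Set.mem_univ _))
    (fun ω hω _ ha => iff_of_true ((hAiff ω hω).2 (Or.inl ha)) (Set.mem_univ _))
    (fun ω hω ha hb => by
      rw [hAiff ω hω]
      exact ⟨fun h => h.elim (fun h' => absurd h' ha) fun h' => h'.2, fun h => Or.inr ⟨hb, h⟩⟩)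
    (fun ω hω ha hb => by
      rw [hAiff ω hω]
      exact ⟨fun h => h.elim (fun h' => absurd h' ha) fun h' => absurd h'.1 hb, fun h => absurd h (Set.notMem_empty ω)⟩)
    (univ_insens _) (univ_insens _) (univ_insens _) hKb
  have hB := apex_mass_table w hq0 hxu hxv huv hw (openConn t u) (Tu ∪ Tv) Tu Tu Tu
    (fun ω hω ha hb => by
      rw [hBiff ω hω, Set.mem_union]
      exact ⟨fun h => h.elim Or.inl fun h' => Or.inr h'.2.2, fun h => h.elim Or.inl fun h' => Or.inr ⟨ha, hb, h'⟩⟩)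
    (fun ω hω hb _ => by
      rw [hBiff ω hω]
      exact ⟨fun h => h.elim id fun h' => absurd h'.2.1 hb, Or.inl⟩)
    (fun ω hω ha _ => by
      rw [hBiff ω hω]
      exact ⟨fun h => h.elim id fun h' => absurd h'.1 ha, Or.inl⟩)
    (fun ω hω ha _ => by
      rw [hBiff ω hω]
      exact ⟨fun h => h.elim id fun h' => absurd h'.1 ha, Or.inl⟩)
    (union_insens hTua hTva) (union_insens hTub hTvb) hTua hTub
  have hAB := apex_mass_table w hq0 hxu hxv huv hw (openConn x u ∩ openConn t u) (Tu ∪ Tv) Tu (K ∩ Tu) ∅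
    (fun ω hω ha hb => by
      rw [Set.mem_inter_iff, hAiff ω hω, hBiff ω hω, Set.mem_union]
      exact ⟨fun h => h.2.elim Or.inl fun h' => Or.inr h'.2.2, fun h => ⟨Or.inl ha, h.elim Or.inl fun h' => Or.inr ⟨ha, hb, h'⟩⟩⟩)
    (fun ω hω hb ha => by
      rw [Set.mem_inter_iff, hAiff ω hω, hBiff ω hω]
      exact ⟨fun h => h.2.elim id fun h' => absurd h'.2.1 hb, fun h => ⟨Or.inl ha, Or.inl h⟩⟩)
    (fun ω hω ha hb => by
      rw [Set.mem_inter_iff, hAiff ω hω, hBiff ω hω, Set.mem_inter_iff]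
      exact ⟨fun h => ⟨h.1.elim (fun h' => absurd h' ha) fun h' => h'.2, h.2.elim id fun h' => absurd h'.1 ha⟩,
        fun h => ⟨Or.inr ⟨hb, h.1⟩, Or.inl h.2⟩⟩)
    (fun ω hω ha hb => by
      rw [Set.mem_inter_iff, hAiff ω hω]
      exact ⟨fun h => h.1.elim (fun h' => absurd h' ha) fun h' => absurd h'.1 hb, fun h => absurd h (Set.notMem_empty ω)⟩)
    (union_insens hTua hTva) (union_insens hTub hTvb) hTua (inter_insens hKb hTub)
  have hZ := apex_mass_table w hq0 hxu hxv huv hw Set.univ Set.univ Set.univ Set.univ Set.univ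
    (fun _ _ _ _ => Iff.rfl) (fun _ _ _ _ => Iff.rfl) (fun _ _ _ _ => Iff.rfl) (fun _ _ _ _ => Iff.rfl)
    (univ_insens _) (univ_insens _) (univ_insens _) (univ_insens _)
  rw [← hK] at hA hB hAB hZ
  have h1 : K ∩ Tv ⊆ Tu := fun ω h => (hTuiff ω).2 (((hKiff ω).1 h.1).trans ((hTviff ω).1 h.2))
  have h2 : K ∩ Tu ⊆ Tv := fun ω h => (hTviff ω).2 (((hKiff ω).1 h.1).symm.trans ((hTuiff ω).1 h.2))
  have h3 : Tu ∩ Tv ⊆ K := fun ω h => (hKiff ω).2 (((hTuiff ω).1 h.1).trans ((hTviff ω).1 h.2).symm)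
  set w0 := Function.update (Function.update w s(u, x) 0) s(x, v) 0 with hw0
  have hd1 : ((w0 s(u, x) : unitInterval) : ℝ) = 0 := apexDead_fst w hxu huv
  have hd2 : ((w0 s(x, v) : unitInterval) : ℝ) = 0 := apexDead_snd w u v x
  have euniv := cells_univ w0 q (K := K) (T := Tu) (T' := Tv)
  have eKc := cells_Kc w0 q (K := K) (T := Tu) (T' := Tv)
  have eK := cells_K w0 q (K := K) (T := Tu)
  have eT := cells_T w0 q (K := K) (T := Tu)
  have eU := cells_U w0 q h1
  have eUKc := cells_UKc w0 q (K := K) (T := Tu) (T' := Tv)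
  have hE : ∑ ω : BondConfig V, rcWeightW w0 q ∅ ω * ind (∅ : Set (BondConfig V)) ω = 0 := sum_rcWeightW_ind_empty w0 q
  have hmass := mass_le_of_real_mul_le w0 hq (openConn v u) (openConn t u) hrest
  have eA0 : ∑ ω : BondConfig V, rcWeightW w0 q ∅ ω * ind (openConn v u : Set (BondConfig V)) ω =
      ∑ ω : BondConfig V, rcWeightW w0 q ∅ ω * ind K ω :=
    sum_rcWeightW_ind_congr_ae w0 q fun ω hω => by
      rw [openConn_comm, mem_openConn_iff', hKiff ω, diff_apex_eq_self_ae w0 q hd1 hd2 hω]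
  have eB0 : ∑ ω : BondConfig V, rcWeightW w0 q ∅ ω * ind (openConn t u : Set (BondConfig V)) ω =
      ∑ ω : BondConfig V, rcWeightW w0 q ∅ ω * ind Tu ω :=
    sum_rcWeightW_ind_congr_ae w0 q fun ω hω => by
      rw [openConn_comm, mem_openConn_iff', hTuiff ω, diff_apex_eq_self_ae w0 q hd1 hd2 hω]
  have eAB0 : ∑ ω : BondConfig V, rcWeightW w0 q ∅ ω * ind ((openConn v u : Set (BondConfig V)) ∩ openConn t u) ω =
      ∑ ω : BondConfig V, rcWeightW w0 q ∅ ω * ind (K ∩ Tu) ω :=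
    sum_rcWeightW_ind_congr_ae w0 q fun ω hω => by
      rw [Set.mem_inter_iff, Set.mem_inter_iff, openConn_comm v u, mem_openConn_iff', openConn_comm t u, mem_openConn_iff',
        hKiff ω, hTuiff ω, diff_apex_eq_self_ae w0 q hd1 hd2 hω]
  rw [eA0, eB0, eAB0, ← sum_rcWeightW_ind_univ w0 q, euniv, eK, eT] at hmass
  have hc := fun S : Set (BondConfig V) => sum_rcWeightW_ind_nonneg w0 hq.le S
  have ha0 : 0 ≤ ((w s(u, x) : unitInterval) : ℝ) := (w s(u, x)).2.1
  have ha1 : 0 ≤ 1 - ((w s(u, x) : unitInterval) : ℝ) := sub_nonneg.2 (w s(u, x)).2.2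
  have hb0 : 0 ≤ ((w s(x, v) : unitInterval) : ℝ) := (w s(x, v)).2.1
  have hb1 : 0 ≤ 1 - ((w s(x, v) : unitInterval) : ℝ) := sub_nonneg.2 (w s(x, v)).2.2
  have hr : 0 ≤ q⁻¹ := inv_nonneg.2 hq.le
  unfold HubUnder
  apply real_mul_le_of_mass w hq
  rw [← sum_rcWeightW_ind_univ w q]
  exact apex_rest_o_alg ha0 ha1 hb0 hb1 hr (hc _) (hc _) (hc _) (hc _) (hc _) (sub_nonneg.2 hmass)
    (hA.trans (by rw [Set.univ_inter, eKc, euniv, eK, hE])) (hB.trans (by rw [eUKc, eU, eT]))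
    (hAB.trans (by rw [eUKc, eU, eT, hE])) (hZ.trans (by rw [Set.univ_inter, eKc, euniv]))

/-- **Reduction `(u; x; t) ← (u; v; t)`** (hub at the apex): for an apex `x` over `(u, v)` and any `t ≠ x`,
`φ_{w,q}(u ↔ x)·φ_{w,q}(t ↔ x) ≤ φ_{w,q}(u ↔ x ↔ t)` follows from `φ°(u ↔ v)·φ°(t ↔ v) ≤ φ°(u ↔ v ↔ t)` in the rest, EVERY `q > 0`.
[cite: AyyerLinussonRavichandran2025, §7 eq. (13)–(14) (p. 22)] [cite: Grimmett2006, §3.9 (p. 63); Thm. (3.8)] -/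
theorem hubUnder_apex_rest_a (w : Sym2 V → unitInterval) {q : ℝ} (hq : 0 < q) {u v x t : V} (hxu : x ≠ u) (hxv : x ≠ v)
    (huv : u ≠ v) (htx : t ≠ x) (hw : ∀ e : Sym2 V, x ∈ e → ((w e : unitInterval) : ℝ) ≠ 0 → u ∈ e ∨ v ∈ e)
    (hrest : HubUnder (rcMeasureW (Function.update (Function.update w s(u, x) 0) s(x, v) 0) q ∅) u v t) :
    HubUnder (rcMeasureW w q ∅) u x t := by
  have hq0 : q ≠ 0 := hq.ne'
  set K : Set (BondConfig V) := {ω : BondConfig V | ω \ {s(u, x), s(x, v)} ∈ (openConn u v : Set (BondConfig V))} with hK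
  set Tu : Set (BondConfig V) := {ω : BondConfig V | ω \ {s(u, x), s(x, v)} ∈ (openConn u t : Set (BondConfig V))} with hTu
  set Tv : Set (BondConfig V) := {ω : BondConfig V | ω \ {s(u, x), s(x, v)} ∈ (openConn v t : Set (BondConfig V))} with hTv
  have hKb : ∀ ω : BondConfig V, ω ∆ {s(x, v)} ∈ K ↔ ω ∈ K := apexAvoid_insens u v x (Or.inr rfl)
  have hTua : ∀ ω : BondConfig V, ω ∆ {s(u, x)} ∈ Tu ↔ ω ∈ Tu := diffApex_insens u v x _ (Or.inl rfl)
  have hTub : ∀ ω : BondConfig V, ω ∆ {s(x, v)} ∈ Tu ↔ ω ∈ Tu := diffApex_insens u v x _ (Or.inr rfl)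
  have hTva : ∀ ω : BondConfig V, ω ∆ {s(u, x)} ∈ Tv ↔ ω ∈ Tv := diffApex_insens u v x _ (Or.inl rfl)
  have hTvb : ∀ ω : BondConfig V, ω ∆ {s(x, v)} ∈ Tv ↔ ω ∈ Tv := diffApex_insens u v x _ (Or.inr rfl)
  have hapex := fun ω (hω : rcWeightW w q ∅ ω ≠ 0) => apex_of_rcWeightW_ne_zero w q hxu hxv hw hω
  have hKiff : ∀ ω : BondConfig V, ω ∈ K ↔ (openGraph (ω \ {s(u, x), s(x, v)})).Reachable u v := fun ω => by
    rw [hK, Set.mem_setOf_eq, mem_openConn_iff']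
  have hTuiff : ∀ ω : BondConfig V, ω ∈ Tu ↔ (openGraph (ω \ {s(u, x), s(x, v)})).Reachable u t := fun ω => by
    rw [hTu, Set.mem_setOf_eq, mem_openConn_iff']
  have hTviff : ∀ ω : BondConfig V, ω ∈ Tv ↔ (openGraph (ω \ {s(u, x), s(x, v)})).Reachable v t := fun ω => by
    rw [hTv, Set.mem_setOf_eq, mem_openConn_iff']
  have hAiff : ∀ ω, rcWeightW w q ∅ ω ≠ 0 →
      (ω ∈ (openConn u x : Set (BondConfig V)) ↔ s(u, x) ∈ ω ∨ (s(x, v) ∈ ω ∧ ω ∈ K)) := fun ω hω => by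
    rw [mem_openConn_iff', reachable_ux_apex_iff hxu hxv (hapex ω hω), hKiff]
  have hBiff : ∀ ω, rcWeightW w q ∅ ω ≠ 0 →
      (ω ∈ (openConn t x : Set (BondConfig V)) ↔ (s(u, x) ∈ ω ∧ ω ∈ Tu) ∨ (s(x, v) ∈ ω ∧ ω ∈ Tv)) := fun ω hω => by
    rw [mem_openConn_apex_iff hxv htx.symm (hapex ω hω), hTuiff, hTviff, mem_openConn_iff', mem_openConn_iff']
  have hA := apex_mass_table w hq0 hxu hxv huv hw (openConn u x) Set.univ Set.univ K ∅
    (fun ω hω ha _ => iff_of_true ((hAiff ω hω).2 (Or.inl ha)) (Set.mem_univ _))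
    (fun ω hω _ ha => iff_of_true ((hAiff ω hω).2 (Or.inl ha)) (Set.mem_univ _))
    (fun ω hω ha hb => by
      rw [hAiff ω hω]
      exact ⟨fun h => h.elim (fun h' => absurd h' ha) fun h' => h'.2, fun h => Or.inr ⟨hb, h⟩⟩)
    (fun ω hω ha hb => by
      rw [hAiff ω hω]
      exact ⟨fun h => h.elim (fun h' => absurd h' ha) fun h' => absurd h'.1 hb, fun h => absurd h (Set.notMem_empty ω)⟩)
    (univ_insens _) (univ_insens _) (univ_insens _) hKb
  have hB := apex_mass_table w hq0 hxu hxv huv hw (openConn t x) (Tu ∪ Tv) Tu Tv ∅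
    (fun ω hω ha hb => by
      rw [hBiff ω hω, Set.mem_union]
      exact ⟨fun h => h.elim (fun h' => Or.inl h'.2) fun h' => Or.inr h'.2, fun h => h.elim (fun h' => Or.inl ⟨ha, h'⟩) fun h' => Or.inr ⟨hb, h'⟩⟩)
    (fun ω hω hb ha => by
      rw [hBiff ω hω]
      exact ⟨fun h => h.elim (fun h' => h'.2) fun h' => absurd h'.1 hb, fun h => Or.inl ⟨ha, h⟩⟩)
    (fun ω hω ha hb => by
      rw [hBiff ω hω]
      exact ⟨fun h => h.elim (fun h' => absurd h'.1 ha) fun h' => h'.2, fun h => Or.inr ⟨hb, h⟩⟩)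
    (fun ω hω ha hb => by
      rw [hBiff ω hω]
      exact ⟨fun h => h.elim (fun h' => absurd h'.1 ha) fun h' => absurd h'.1 hb, fun h => absurd h (Set.notMem_empty ω)⟩)
    (union_insens hTua hTva) (union_insens hTub hTvb) hTua hTvb
  have hAB := apex_mass_table w hq0 hxu hxv huv hw (openConn u x ∩ openConn t x) (Tu ∪ Tv) Tu (K ∩ Tv) ∅
    (fun ω hω ha hb => by
      rw [Set.mem_inter_iff, hAiff ω hω, hBiff ω hω, Set.mem_union]
      exact ⟨fun h => h.2.elim (fun h' => Or.inl h'.2) fun h' => Or.inr h'.2,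
        fun h => ⟨Or.inl ha, h.elim (fun h' => Or.inl ⟨ha, h'⟩) fun h' => Or.inr ⟨hb, h'⟩⟩⟩)
    (fun ω hω hb ha => by
      rw [Set.mem_inter_iff, hAiff ω hω, hBiff ω hω]
      exact ⟨fun h => h.2.elim (fun h' => h'.2) fun h' => absurd h'.1 hb, fun h => ⟨Or.inl ha, Or.inl ⟨ha, h⟩⟩⟩)
    (fun ω hω ha hb => by
      rw [Set.mem_inter_iff, hAiff ω hω, hBiff ω hω, Set.mem_inter_iff]
      exact ⟨fun h => ⟨h.1.elim (fun h' => absurd h' ha) fun h' => h'.2, h.2.elim (fun h' => absurd h'.1 ha) fun h' => h'.2⟩,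
        fun h => ⟨Or.inr ⟨hb, h.1⟩, Or.inr ⟨hb, h.2⟩⟩⟩)
    (fun ω hω ha hb => by
      rw [Set.mem_inter_iff, hAiff ω hω]
      exact ⟨fun h => h.1.elim (fun h' => absurd h' ha) fun h' => absurd h'.1 hb, fun h => absurd h (Set.notMem_empty ω)⟩)
    (union_insens hTua hTva) (union_insens hTub hTvb) hTua (inter_insens hKb hTvb)
  have hZ := apex_mass_table w hq0 hxu hxv huv hw Set.univ Set.univ Set.univ Set.univ Set.univ
    (fun _ _ _ _ => Iff.rfl) (fun _ _ _ _ => Iff.rfl) (fun _ _ _ _ => Iff.rfl) (fun _ _ _ _ => Iff.rfl)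
    (univ_insens _) (univ_insens _) (univ_insens _) (univ_insens _)
  rw [← hK] at hA hB hAB hZ
  have h1 : K ∩ Tv ⊆ Tu := fun ω h => (hTuiff ω).2 (((hKiff ω).1 h.1).trans ((hTviff ω).1 h.2))
  have h2 : K ∩ Tu ⊆ Tv := fun ω h => (hTviff ω).2 (((hKiff ω).1 h.1).symm.trans ((hTuiff ω).1 h.2))
  have h3 : Tu ∩ Tv ⊆ K := fun ω h => (hKiff ω).2 (((hTuiff ω).1 h.1).trans ((hTviff ω).1 h.2).symm)
  set w0 := Function.update (Function.update w s(u, x) 0) s(x, v) 0 with hw0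
  have hd1 : ((w0 s(u, x) : unitInterval) : ℝ) = 0 := apexDead_fst w hxu huv
  have hd2 : ((w0 s(x, v) : unitInterval) : ℝ) = 0 := apexDead_snd w u v x
  have euniv := cells_univ w0 q (K := K) (T := Tu) (T' := Tv)
  have eKc := cells_Kc w0 q (K := K) (T := Tu) (T' := Tv)
  have eK := cells_K w0 q (K := K) (T := Tu)
  have eT := cells_T w0 q (K := K) (T := Tu)
  have eTv := cells_T' w0 q h1 h2 h3
  have eKTv := cells_KT' w0 q h1 h2
  have eU := cells_U w0 q h1
  have eUKc := cells_UKc w0 q (K := K) (T := Tu) (T' := Tv)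
  have hE : ∑ ω : BondConfig V, rcWeightW w0 q ∅ ω * ind (∅ : Set (BondConfig V)) ω = 0 := sum_rcWeightW_ind_empty w0 q
  have hmass := mass_le_of_real_mul_le w0 hq (openConn u v) (openConn t v) hrest
  have eA0 : ∑ ω : BondConfig V, rcWeightW w0 q ∅ ω * ind (openConn u v : Set (BondConfig V)) ω =
      ∑ ω : BondConfig V, rcWeightW w0 q ∅ ω * ind K ω :=
    sum_rcWeightW_ind_congr_ae w0 q fun ω hω => by
      rw [mem_openConn_iff', hKiff ω, diff_apex_eq_self_ae w0 q hd1 hd2 hω]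
  have eB0 : ∑ ω : BondConfig V, rcWeightW w0 q ∅ ω * ind (openConn t v : Set (BondConfig V)) ω =
      ∑ ω : BondConfig V, rcWeightW w0 q ∅ ω * ind Tv ω :=
    sum_rcWeightW_ind_congr_ae w0 q fun ω hω => by
      rw [openConn_comm, mem_openConn_iff', hTviff ω, diff_apex_eq_self_ae w0 q hd1 hd2 hω]
  have eAB0 : ∑ ω : BondConfig V, rcWeightW w0 q ∅ ω * ind ((openConn u v : Set (BondConfig V)) ∩ openConn t v) ω =
      ∑ ω : BondConfig V, rcWeightW w0 q ∅ ω * ind (K ∩ Tv) ω :=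
    sum_rcWeightW_ind_congr_ae w0 q fun ω hω => by
      rw [Set.mem_inter_iff, Set.mem_inter_iff, mem_openConn_iff', openConn_comm t v, mem_openConn_iff',
        hKiff ω, hTviff ω, diff_apex_eq_self_ae w0 q hd1 hd2 hω]
  rw [eA0, eB0, eAB0, ← sum_rcWeightW_ind_univ w0 q, euniv, eK, eTv, eKTv] at hmass
  have hc := fun S : Set (BondConfig V) => sum_rcWeightW_ind_nonneg w0 hq.le S
  have ha0 : 0 ≤ ((w s(u, x) : unitInterval) : ℝ) := (w s(u, x)).2.1
  have ha1 : 0 ≤ 1 - ((w s(u, x) : unitInterval) : ℝ) := sub_nonneg.2 (w s(u, x)).2.2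
  have hb0 : 0 ≤ ((w s(x, v) : unitInterval) : ℝ) := (w s(x, v)).2.1
  have hb1 : 0 ≤ 1 - ((w s(x, v) : unitInterval) : ℝ) := sub_nonneg.2 (w s(x, v)).2.2
  have hr : 0 ≤ q⁻¹ := inv_nonneg.2 hq.le
  unfold HubUnder
  apply real_mul_le_of_mass w hq
  rw [← sum_rcWeightW_ind_univ w q]
  exact apex_rest_a_alg ha0 ha1 hb0 hb1 hr (hc _) (hc _) (hc _) (hc _) (hc _) (sub_nonneg.2 hmass)
    (hA.trans (by rw [Set.univ_inter, eKc, euniv, eK, hE])) (hB.trans (by rw [eUKc, eU, eT, eTv, hE]))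
    (hAB.trans (by rw [eUKc, eU, eT, eKTv, hE])) (hZ.trans (by rw [Set.univ_inter, eKc, euniv]))

/-- **Reduction `(x; t; u) ← (u; t; v)`** (hub in the rest): for an apex `x` over `(u, v)` and any `t ≠ x`,
`φ_{w,q}(x ↔ t)·φ_{w,q}(u ↔ t) ≤ φ_{w,q}(x ↔ t ↔ u)` follows from `φ°(u ↔ t)·φ°(v ↔ t) ≤ φ°(u ↔ t ↔ v)` in the rest, EVERY `q > 0`.
[cite: AyyerLinussonRavichandran2025, §7 eq. (13)–(14) (p. 22)] [cite: Grimmett2006, §3.9 (p. 63); Thm. (3.8)] -/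
theorem hubUnder_apex_rest_b (w : Sym2 V → unitInterval) {q : ℝ} (hq : 0 < q) {u v x t : V} (hxu : x ≠ u) (hxv : x ≠ v)
    (huv : u ≠ v) (htx : t ≠ x) (hw : ∀ e : Sym2 V, x ∈ e → ((w e : unitInterval) : ℝ) ≠ 0 → u ∈ e ∨ v ∈ e)
    (hrest : HubUnder (rcMeasureW (Function.update (Function.update w s(u, x) 0) s(x, v) 0) q ∅) u t v) :
    HubUnder (rcMeasureW w q ∅) x t u := by
  have hq0 : q ≠ 0 := hq.ne'
  set K : Set (BondConfig V) := {ω : BondConfig V | ω \ {s(u, x), s(x, v)} ∈ (openConn u v : Set (BondConfig V))} with hK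
  set Tu : Set (BondConfig V) := {ω : BondConfig V | ω \ {s(u, x), s(x, v)} ∈ (openConn u t : Set (BondConfig V))} with hTu
  set Tv : Set (BondConfig V) := {ω : BondConfig V | ω \ {s(u, x), s(x, v)} ∈ (openConn v t : Set (BondConfig V))} with hTv
  have hTua : ∀ ω : BondConfig V, ω ∆ {s(u, x)} ∈ Tu ↔ ω ∈ Tu := diffApex_insens u v x _ (Or.inl rfl)
  have hTub : ∀ ω : BondConfig V, ω ∆ {s(x, v)} ∈ Tu ↔ ω ∈ Tu := diffApex_insens u v x _ (Or.inr rfl)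
  have hTva : ∀ ω : BondConfig V, ω ∆ {s(u, x)} ∈ Tv ↔ ω ∈ Tv := diffApex_insens u v x _ (Or.inl rfl)
  have hTvb : ∀ ω : BondConfig V, ω ∆ {s(x, v)} ∈ Tv ↔ ω ∈ Tv := diffApex_insens u v x _ (Or.inr rfl)
  have hapex := fun ω (hω : rcWeightW w q ∅ ω ≠ 0) => apex_of_rcWeightW_ne_zero w q hxu hxv hw hω
  have hKiff : ∀ ω : BondConfig V, ω ∈ K ↔ (openGraph (ω \ {s(u, x), s(x, v)})).Reachable u v := fun ω => by
    rw [hK, Set.mem_setOf_eq, mem_openConn_iff']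
  have hTuiff : ∀ ω : BondConfig V, ω ∈ Tu ↔ (openGraph (ω \ {s(u, x), s(x, v)})).Reachable u t := fun ω => by
    rw [hTu, Set.mem_setOf_eq, mem_openConn_iff']
  have hTviff : ∀ ω : BondConfig V, ω ∈ Tv ↔ (openGraph (ω \ {s(u, x), s(x, v)})).Reachable v t := fun ω => by
    rw [hTv, Set.mem_setOf_eq, mem_openConn_iff']
  have hAiff : ∀ ω, rcWeightW w q ∅ ω ≠ 0 →
      (ω ∈ (openConn x t : Set (BondConfig V)) ↔ (s(u, x) ∈ ω ∧ ω ∈ Tu) ∨ (s(x, v) ∈ ω ∧ ω ∈ Tv)) := fun ω hω => by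
    rw [openConn_comm, mem_openConn_apex_iff hxv htx.symm (hapex ω hω), hTuiff, hTviff, mem_openConn_iff', mem_openConn_iff']
  have hBiff : ∀ ω, rcWeightW w q ∅ ω ≠ 0 →
      (ω ∈ (openConn u t : Set (BondConfig V)) ↔ ω ∈ Tu ∨ (s(u, x) ∈ ω ∧ s(x, v) ∈ ω ∧ ω ∈ Tv)) := fun ω hω => by
    rw [mem_openConn_iff', reachable_uy_apex_iff hxu hxv htx (hapex ω hω), hTuiff, hTviff]
  have hA := apex_mass_table w hq0 hxu hxv huv hw (openConn x t) (Tu ∪ Tv) Tu Tv ∅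
    (fun ω hω ha hb => by
      rw [hAiff ω hω, Set.mem_union]
      exact ⟨fun h => h.elim (fun h' => Or.inl h'.2) fun h' => Or.inr h'.2, fun h => h.elim (fun h' => Or.inl ⟨ha, h'⟩) fun h' => Or.inr ⟨hb, h'⟩⟩)
    (fun ω hω hb ha => by
      rw [hAiff ω hω]
      exact ⟨fun h => h.elim (fun h' => h'.2) fun h' => absurd h'.1 hb, fun h => Or.inl ⟨ha, h⟩⟩)
    (fun ω hω ha hb => by
      rw [hAiff ω hω]
      exact ⟨fun h => h.elim (fun h' => absurd h'.1 ha) fun h' => h'.2, fun h => Or.inr ⟨hb, h⟩⟩)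
    (fun ω hω ha hb => by
      rw [hAiff ω hω]
      exact ⟨fun h => h.elim (fun h' => absurd h'.1 ha) fun h' => absurd h'.1 hb, fun h => absurd h (Set.notMem_empty ω)⟩)
    (union_insens hTua hTva) (union_insens hTub hTvb) hTua hTvb
  have hB := apex_mass_table w hq0 hxu hxv huv hw (openConn u t) (Tu ∪ Tv) Tu Tu Tu
    (fun ω hω ha hb => by
      rw [hBiff ω hω, Set.mem_union]
      exact ⟨fun h => h.elim Or.inl fun h' => Or.inr h'.2.2, fun h => h.elim Or.inl fun h' => Or.inr ⟨ha, hb, h'⟩⟩)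
    (fun ω hω hb _ => by
      rw [hBiff ω hω]
      exact ⟨fun h => h.elim id fun h' => absurd h'.2.1 hb, Or.inl⟩)
    (fun ω hω ha _ => by
      rw [hBiff ω hω]
      exact ⟨fun h => h.elim id fun h' => absurd h'.1 ha, Or.inl⟩)
    (fun ω hω ha _ => by
      rw [hBiff ω hω]
      exact ⟨fun h => h.elim id fun h' => absurd h'.1 ha, Or.inl⟩)
    (union_insens hTua hTva) (union_insens hTub hTvb) hTua hTub
  have hAB := apex_mass_table w hq0 hxu hxv huv hw (openConn x t ∩ openConn u t) (Tu ∪ Tv) Tu (Tu ∩ Tv) ∅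
    (fun ω hω ha hb => by
      rw [Set.mem_inter_iff, hAiff ω hω, hBiff ω hω, Set.mem_union]
      exact ⟨fun h => h.2.elim Or.inl fun h' => Or.inr h'.2.2,
        fun h => ⟨h.elim (fun h' => Or.inl ⟨ha, h'⟩) fun h' => Or.inr ⟨hb, h'⟩, h.elim Or.inl fun h' => Or.inr ⟨ha, hb, h'⟩⟩⟩)
    (fun ω hω hb ha => by
      rw [Set.mem_inter_iff, hAiff ω hω, hBiff ω hω]
      exact ⟨fun h => h.2.elim id fun h' => absurd h'.2.1 hb, fun h => ⟨Or.inl ⟨ha, h⟩, Or.inl h⟩⟩)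
    (fun ω hω ha hb => by
      rw [Set.mem_inter_iff, hAiff ω hω, hBiff ω hω, Set.mem_inter_iff]
      exact ⟨fun h => ⟨h.2.elim id fun h' => absurd h'.1 ha, h.1.elim (fun h' => absurd h'.1 ha) fun h' => h'.2⟩,
        fun h => ⟨Or.inr ⟨hb, h.2⟩, Or.inl h.1⟩⟩)
    (fun ω hω ha hb => by
      rw [Set.mem_inter_iff, hAiff ω hω]
      exact ⟨fun h => h.1.elim (fun h' => absurd h'.1 ha) fun h' => absurd h'.1 hb, fun h => absurd h (Set.notMem_empty ω)⟩)
    (union_insens hTua hTva) (union_insens hTub hTvb) hTua (inter_insens hTub hTvb)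
  have hZ := apex_mass_table w hq0 hxu hxv huv hw Set.univ Set.univ Set.univ Set.univ Set.univ
    (fun _ _ _ _ => Iff.rfl) (fun _ _ _ _ => Iff.rfl) (fun _ _ _ _ => Iff.rfl) (fun _ _ _ _ => Iff.rfl)
    (univ_insens _) (univ_insens _) (univ_insens _) (univ_insens _)
  rw [← hK] at hA hB hAB hZ
  have h1 : K ∩ Tv ⊆ Tu := fun ω h => (hTuiff ω).2 (((hKiff ω).1 h.1).trans ((hTviff ω).1 h.2))
  have h2 : K ∩ Tu ⊆ Tv := fun ω h => (hTviff ω).2 (((hKiff ω).1 h.1).symm.trans ((hTuiff ω).1 h.2))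
  have h3 : Tu ∩ Tv ⊆ K := fun ω h => (hKiff ω).2 (((hTuiff ω).1 h.1).trans ((hTviff ω).1 h.2).symm)
  set w0 := Function.update (Function.update w s(u, x) 0) s(x, v) 0 with hw0
  have hd1 : ((w0 s(u, x) : unitInterval) : ℝ) = 0 := apexDead_fst w hxu huv
  have hd2 : ((w0 s(x, v) : unitInterval) : ℝ) = 0 := apexDead_snd w u v x
  have euniv := cells_univ w0 q (K := K) (T := Tu) (T' := Tv)
  have eKc := cells_Kc w0 q (K := K) (T := Tu) (T' := Tv)
  have eT := cells_T w0 q (K := K) (T := Tu)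
  have eTv := cells_T' w0 q h1 h2 h3
  have eTT := cells_TT' w0 q h2 h3
  have eU := cells_U w0 q h1
  have eUKc := cells_UKc w0 q (K := K) (T := Tu) (T' := Tv)
  have hE : ∑ ω : BondConfig V, rcWeightW w0 q ∅ ω * ind (∅ : Set (BondConfig V)) ω = 0 := sum_rcWeightW_ind_empty w0 q
  have hmass := mass_le_of_real_mul_le w0 hq (openConn u t) (openConn v t) hrest
  have eA0 : ∑ ω : BondConfig V, rcWeightW w0 q ∅ ω * ind (openConn u t : Set (BondConfig V)) ω =
      ∑ ω : BondConfig V, rcWeightW w0 q ∅ ω * ind Tu ω :=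
    sum_rcWeightW_ind_congr_ae w0 q fun ω hω => by
      rw [mem_openConn_iff', hTuiff ω, diff_apex_eq_self_ae w0 q hd1 hd2 hω]
  have eB0 : ∑ ω : BondConfig V, rcWeightW w0 q ∅ ω * ind (openConn v t : Set (BondConfig V)) ω =
      ∑ ω : BondConfig V, rcWeightW w0 q ∅ ω * ind Tv ω :=
    sum_rcWeightW_ind_congr_ae w0 q fun ω hω => by
      rw [mem_openConn_iff', hTviff ω, diff_apex_eq_self_ae w0 q hd1 hd2 hω]
  have eAB0 : ∑ ω : BondConfig V, rcWeightW w0 q ∅ ω * ind ((openConn u t : Set (BondConfig V)) ∩ openConn v t) ω =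
      ∑ ω : BondConfig V, rcWeightW w0 q ∅ ω * ind (Tu ∩ Tv) ω :=
    sum_rcWeightW_ind_congr_ae w0 q fun ω hω => by
      rw [Set.mem_inter_iff, Set.mem_inter_iff, mem_openConn_iff', mem_openConn_iff', hTuiff ω, hTviff ω,
        diff_apex_eq_self_ae w0 q hd1 hd2 hω]
  rw [eA0, eB0, eAB0, ← sum_rcWeightW_ind_univ w0 q, euniv, eT, eTv, eTT] at hmass
  have hc := fun S : Set (BondConfig V) => sum_rcWeightW_ind_nonneg w0 hq.le S
  have ha0 : 0 ≤ ((w s(u, x) : unitInterval) : ℝ) := (w s(u, x)).2.1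
  have ha1 : 0 ≤ 1 - ((w s(u, x) : unitInterval) : ℝ) := sub_nonneg.2 (w s(u, x)).2.2
  have hb0 : 0 ≤ ((w s(x, v) : unitInterval) : ℝ) := (w s(x, v)).2.1
  have hb1 : 0 ≤ 1 - ((w s(x, v) : unitInterval) : ℝ) := sub_nonneg.2 (w s(x, v)).2.2
  have hr : 0 ≤ q⁻¹ := inv_nonneg.2 hq.le
  unfold HubUnder
  apply real_mul_le_of_mass w hq
  rw [← sum_rcWeightW_ind_univ w q]
  exact apex_rest_b_alg ha0 ha1 hb0 hb1 hr (hc _) (hc _) (hc _) (hc _) (hc _) (sub_nonneg.2 hmass)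
    (hA.trans (by rw [eUKc, eU, eT, eTv, hE])) (hB.trans (by rw [eUKc, eU, eT]))
    (hAB.trans (by rw [eUKc, eU, eT, eTT, hE])) (hZ.trans (by rw [Set.univ_inter, eKc, euniv]))

end FK

end Summit.CriticalPhenomena.PercolationContinuityZ3.Theorems

end
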